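import Literature.NumberTheory.EllipticCurves.Rank1Residual.CornerFTwoCertificates.Claim
import HarnessLib

/-!
# The CM corner at `p = 2` in analytic rank one (leaf `CornerF @ 2`) — certificate records of the KRIZ–LI quadratic-twist families (Kriz–Li 2019 Thm. 1.12 at a CM base `E` and a Heegner field `K` in which `2` splits): the record schema, its in-kernel recheck, and what a certified record decodes to

HONEST FRAMING (cell `bsd-print-cf2`, run/shared/lean/pub/bsd-print-cf2/, D-0131 (2) PRINT TIER, seat
ty3; verbatim): PARTITION currency only — the leaf `CornerF @ 2` (`W/ℚ` with complex multiplication,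
analytic rank `1`, the prime `2`) counts when its class theorem is in the kernel BY NAME; Literature
named facts are statement-only with cite tags; every imported theorem carries its printed hypotheses
verbatim. The leaf is OPEN AS A CLASS. Companion of `Schema.lean` (`E_n`, cube sums) and
`TwistSchema.lean` (Shu–Zhai twists, `2` NONSPLIT in `K`) for the KRIZ–LI DOOR: Kriz–Li 2019 Thm. 1.12
(= FMS Thm. 5.1; tree fact `KrizLi2019.thm112_bsdTwo_twist`) — for `E/ℚ` with `E(ℚ)[2] = 0`, an
imaginary quadratic `K` with the Heegner hypothesis in which `2` SPLITS, Assumption (★) on the `2`-adic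
logarithm of the Heegner point and `c₂(E)` odd, and `d` in the set `𝒩(E, K)` of Def. 4.1 (square-free,
`d ≡ 1 (mod 4)`, every prime `ℓ ∣ d` SILENT: `ℓ ∤ 2N`, `ℓ` split in `K`, `a_ℓ(E)` odd): rank
`= r_an ∈ {0, 1}` and `BSD(·, 2)` for `E^{(d)}` and `E^{(d·d_K)}`, granted `BSD(E, 2)` and
`BSD(E^{(d_K)}, 2)`. At a CM base with `N(E) < 5000` and `r_an(E) = 1` the base inputs are in print
(Creutz–Miller / Miller `N < 5000`; Burungale–Flach for the rank-`0` partner), so the rank-one member of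
each pair lies on the leaf `CornerF @ 2` with `BSD(·, 2)` BY NAME (cell files
`Summit.….P2.KrizLiTwoFortyThree*`, `P2.KrizLiSmallCMBase*`). [cite: KrizLi2019, Thm. 1.12 (FMS Thm. 5.1 (2)), Def. 4.1 and §6 Table 1]

THE PRINTED FIBRE is `(E, K) = (243a1, ℚ(√−23))` — Kriz–Li's Table 1 row `243a1 | −23 | ✓` asserts (★)
there (tree fact `KrizLi2019.table1_row243a1`); `243a1 : y² + y = x³ − 1 ≅ y² = x³ − 48` (`j = 0`, CM by
`ℤ[(1+√−3)/2]·3`? — by an order of `ℚ(√−3)`; `2` INERT in the CM field, GOOD at `2`: the INERT-GOOD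
quadrant of the leaf), `𝒮(243a1, ℚ(√−23)) = {ℓ prime : ℓ ∤ 6, (−23/ℓ) = 1, #{x ∈ 𝔽_ℓ : x³ = 48} even}`
(`a_ℓ` odd ⟺ an even number of `𝔽_ℓ`-roots of `x³ = 48`, cell lemma `P2.isKrizLiPrime243_iff`), and the
EXPLICIT members are `d > 0`, `d ≡ 1 (mod 12)`, square-free with all prime factors in `𝒮` (cell theorem
`P2.isKrizLiTwoFortyThreeTwist_of_explicit`; then `χ_d(−N) = 1`, so `E^{(d)}` is the RANK-ONE member and
`E^{(−23d)}` its rank-zero partner). Other `(E, K)` (the eight further `j = 0` bases of the cell's lit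
dossier §14, any `2`-split Heegner `K`) enter with a (★)-CERTIFICATE displayed as a hypothesis; the
schema is written for any base: a record carries `(d_K, c, badPrimes, N(E))` as data.
[cite: KrizLi2019, §6 Ex. 6.2, Rem. 6.3 and Table 1 (row 243a1)]

## What a record records, and what the kernel rechecks (`KLRecord.check`, decidable)

* `fieldDisc = d_K`, `cubeConst = c` (the constant with `a_ℓ(E)` odd ⟺ `#{x ∈ 𝔽_ℓ : x³ = c}` even; `48`
  for `243a1`), `badPrimes` (the primes of `2N(E)`), `baseConductor = N(E)`: the base data (documentation
  + parameters of the recheck; the Summit-side glue pins them per base, e.g. `(−23, 48, [2,3], 243)`).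
* `d`, `primes` (the distinct primes of `d`, increasing). RECHECKED: primality (trial division), no
  duplicates, `d = ∏ primes`, `0 < d`, `d ≡ 1 (mod 12)`; and for every `ℓ ∈ primes`: `ℓ ∉ badPrimes`,
  `ℓ ∤ d_K`, `(d_K/ℓ) ≠ −1` by Euler's criterion (the tree's computable `kroneckerBit d_K ℓ = 0`; with
  `ℓ ∤ d_K` this is `(d_K/ℓ) = 1`: `ℓ` SPLITS in `K`), and an EVEN number of roots of `x³ = c` in `𝔽_ℓ`
  (counted in the kernel) — i.e. `d ∈ 𝒩(E, K)` with `χ_d(−N) = 1`, EXACTLY the hypotheses of the cell's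
  explicit-member theorems (`KLRecord.hyps_of_check` below). [cite: KrizLi2019, Def. 4.1]
* `ainvs` (a global minimal model of the rank-one member `E^{(d)}`; for `243a1`:
  `[0, 0, 1, 0, (−3d³−1)/4]`, RECHECKED as `4·a₆ + 1 = −3d³`), `conductor = N(E)·d²` (RECHECKED as an
  identity; `d` is prime to `2N`).
* `rankMW`, `rankAn`, `rootNumber`, `torsion`, `tamagawa`, `sel2` (`dim Sel₂(E^{(d)}/ℚ)`, no rational
  `2`-torsion), `shaAn`, `ord2ShaAn`, `sha2`, `digits`, `engines`: the TWO-ENGINE numeric columns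
  (P = PARI/GP, S = SageMath; kit jobs named per record). RECHECKED for consistency only: `rankAn = rankMW
  = 1`, `rootNumber = −1` (the leaf), `shaAn` a positive square, `ord2ShaAn = v₂(shaAn)`,
  `sel2 = rankMW + sha2`, two engines, `digits ≥ 1`; AGAINST PRINT: `sel2 = 1`, `sha2 = 0`
  (`Sel₂(E^{(d)}/ℚ) ≅ Sel₂(E/ℚ) ≅ ℤ/2` for `Δ(E) < 0`, Kriz–Li Lemma 5.1 (1)) and `ord2ShaAn = 0`
  (`BSD(E^{(d)}, 2)` with `Ш(E^{(d)})[2] = 0`). [cite: KrizLi2019, Lemma 5.1 (1) (FMS) and Thm. 1.12]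

NOT checked here (CLAIMS about the curve): the ranks, `#Ш_an`, the Selmer group; and NOT Assumption (★)
— printed for `(243a1, ℚ(√−23))`, a displayed certificate elsewhere. `BSD(E^{(d)}, 2)` comes BY NAME from
print (Summit-side glue `Summit.BirchSwinnertonDyer.Rank1Residual.P2.CornerFTwoCertificatesKrizLi`).

## Design

Plain computable data; `decide` (kernel) runs the recheck (the cube-root count is decided IN `𝔽_ℓ`,
`Finset.univ.filter` over `ZMod ℓ`); no `instance` declared; no `native_decide`; kernel arithmetic REUSED
(`isPrimeBelow504100`, `natVal`, `RedeiReichardt.kroneckerBit`). References: [KrizLi2019] Thm. 1.12,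
Def. 4.1, Lemma 5.1, §6 Table 1; [Cremona1997] Table 1 (243A1); [IrelandRosen1990] Ch. 5 §1 (Euler's
criterion); [Miller2011LMS] Def. 1.1; HOME/STATUS.md (ty3 g2 lines); kit jobs j289430 (P), j289431 (S).
-/

open Literature.NumberTheory.QuadraticFields.RedeiReichardt (kroneckerBit kroneckerBit_eq_one_iff_jacobiSym)
open Literature.NumberTheory.EllipticCurves.Rank1Residual.X11RankOneCertificates
  (natVal isPrimeBelow504100 prime_of_isPrimeBelow504100)

namespace Literature.NumberTheory.EllipticCurves.Rank1Residual.CornerFTwoCertificates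

/-- **Kernel-decidable "`a_ℓ(E)` is odd"** for `E ≅ y² = x³ + c` (resp. the base's cubic constant `c`):
an EVEN number of roots of `x³ = c` in `𝔽_ℓ`, decided in `ZMod ℓ` (`false` for `ℓ = 0`).
[cite: KrizLi2019, Def. 4.1 (a_ℓ(E) ≡ 1 (mod 2))] -/
def evenCubeRootCount (c : ℤ) (ℓ : ℕ) : Bool :=
  if h : ℓ = 0 then false
  else
    haveI : NeZero ℓ := ⟨h⟩
    decide (Even ((Finset.univ.filter fun x : ZMod ℓ => x ^ 3 = (c : ZMod ℓ)).card))

/-- Soundness of `evenCubeRootCount`. [cite: KrizLi2019, Def. 4.1 (a_ℓ(E) ≡ 1 (mod 2))] -/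
theorem even_card_of_evenCubeRootCount {c : ℤ} {ℓ : ℕ} [NeZero ℓ] (h : evenCubeRootCount c ℓ = true) :
    Even ((Finset.univ.filter fun x : ZMod ℓ => x ^ 3 = (c : ZMod ℓ)).card) := by
  unfold evenCubeRootCount at h
  rw [dif_neg (NeZero.ne ℓ)] at h
  exact of_decide_eq_true h

/-- **Kernel-decidable "`ℓ` is silent"** (Kriz–Li Def. 4.1 at a base with data `(d_K, c, badPrimes)`):
`ℓ` prime (trial division), `ℓ ∉ badPrimes` (`ℓ ∤ 2N`), `ℓ ∤ d_K` and `kroneckerBit d_K ℓ = 0` (Euler's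
criterion: `(d_K/ℓ) ≠ −1`, hence `= 1`: `ℓ` splits in `K`), and `a_ℓ` odd (`evenCubeRootCount`).
[cite: KrizLi2019, Def. 4.1] [cite: IrelandRosen1990, Ch. 5 §1 Prop. 5.1.2 (Euler's criterion)] -/
def silentBit (dK c : ℤ) (bad : List ℕ) (ℓ : ℕ) : Bool :=
  isPrimeBelow504100 ℓ && !(bad.contains ℓ) && decide (¬ ℓ ∣ dK.natAbs) && decide (kroneckerBit dK ℓ = 0) &&
    evenCubeRootCount c ℓ

/-- One certificate record of a Kriz–Li quadratic-twist family of the leaf `CornerF @ 2`: the DATA of one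
rank-one member `E^{(d)}` (see the module docstring for the meaning of each field). A record asserts
nothing by itself; `KLRecord.check` is its decidable recheck. [cite: KrizLi2019, Thm. 1.12 and Def. 4.1]
[cite: Miller2011LMS, Def. 1.1] -/
structure KLRecord where
  /-- Cremona label of the CM base `E` (documentation). -/
  base : String
  /-- the discriminant `d_K` of the Heegner field `K` (`2` split: `d_K ≡ 1 (mod 8)`). -/
  fieldDisc : ℤ
  /-- the cubic constant `c` of the base: `a_ℓ(E)` odd ⟺ `#{x ∈ 𝔽_ℓ : x³ = c}` even (`48` for `243a1`). -/
  cubeConst : ℤ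
  /-- the primes of `2N(E)`. -/
  badPrimes : List ℕ
  /-- the conductor `N(E)` of the base. -/
  baseConductor : ℕ
  /-- the twisting parameter `d` (`d > 0`, `d ≡ 1 (mod 12)`; the member is `E^{(d)}`, its partner `E^{(d·d_K)}`). -/
  d : ℕ
  /-- the distinct primes of `d` (increasing). -/
  primes : List ℕ
  /-- LMFDB / Cremona label of the member when inside a database range (documentation; `""` otherwise). -/
  label : String
  /-- a-invariants of a global minimal model of `E^{(d)}` (for `243a1`: `[0,0,1,0,(−3d³−1)/4]`). -/
  ainvs : List ℤ
  /-- the conductor of `E^{(d)}` (`= N(E)·d²`). -/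
  conductor : ℕ
  /-- Mordell–Weil rank (engines). -/
  rankMW : ℕ
  /-- analytic rank (engines). -/
  rankAn : ℕ
  /-- global root number (engines). -/
  rootNumber : ℤ
  /-- `#E^{(d)}(ℚ)_tors`. -/
  torsion : ℕ
  /-- Tamagawa product `∏_ℓ c_ℓ`. -/
  tamagawa : ℕ
  /-- `dim_{𝔽₂} Sel₂(E^{(d)}/ℚ)` from `2`-descent (no rational `2`-torsion: `= rank + dim Ш[2]`). -/
  sel2 : ℕ
  /-- the analytic order of `Ш`, rounded (engines agree to `digits` digits that it is this integer). -/
  shaAn : ℕ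
  /-- `v₂(shaAn)`. -/
  ord2ShaAn : ℕ
  /-- `dim_{𝔽₂} Ш(E^{(d)})[2]` from `2`-descent. -/
  sha2 : ℕ
  /-- decimal digits to which the engines agree on `#Ш_an` (min over engines). -/
  digits : ℕ
  /-- provenance strings (engine:job); at least two. -/
  engines : List String
  deriving DecidableEq

namespace KLRecord

variable (r : KLRecord)

/-- Support and membership: primes prime and distinct, `d = ∏ primes`, `0 < d`, `d ≡ 1 (mod 12)`, every
prime silent (`silentBit`). [cite: KrizLi2019, Def. 4.1 and Thm. 1.12 (2)] -/
def checkMember : Bool :=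
  r.primes.all isPrimeBelow504100 && decide r.primes.Nodup && (r.primes.prod == r.d) && decide (0 < r.d) &&
    (r.d % 12 == 1) && r.primes.all (silentBit r.fieldDisc r.cubeConst r.badPrimes)

/-- Model and conductor: `conductor = N(E)·d²`; at the base `243a1` (`N(E) = 243`) the model is
`[0, 0, 1, 0, a₆]` with `4a₆ + 1 = −3d³` (the global minimal model `y² + y = x³ + a₆` of
`243a1^{(d)} : y² = x³ − (3/4)d³`); otherwise five a-invariants (engine output). [cite: KrizLi2019, §6 Ex. 6.2 (243a1)]
[cite: Cremona1997, Table 1 (243A1)] -/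
def checkModel : Bool :=
  (r.conductor == r.baseConductor * r.d ^ 2) &&
  (if r.baseConductor = 243 then
    match r.ainvs with
    | [0, 0, 1, 0, a6] => 4 * a6 + 1 == -(3 * (r.d : ℤ) ^ 3)
    | _ => false
  else r.ainvs.length == 5)

/-- Invariants and the two-engine columns, consistency only: the LEAF (`rankAn = rankMW = 1`,
`rootNumber = −1`), `0 < shaAn` a perfect square, `ord2ShaAn = v₂(shaAn)`, `sel2 = rankMW + sha2`,
`0 < torsion`, `0 < tamagawa`, `1 ≤ digits`, at least two engines. [cite: Miller2011LMS, Def. 1.1] -/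
def checkInvariants : Bool :=
  (r.rankAn == 1) && (r.rankMW == 1) && (r.rootNumber == -1) && decide (0 < r.shaAn) &&
  (Nat.sqrt r.shaAn * Nat.sqrt r.shaAn == r.shaAn) && (r.ord2ShaAn == natVal 2 r.shaAn) &&
  (r.sel2 == r.rankMW + r.sha2) && decide (0 < r.torsion) && decide (0 < r.tamagawa) &&
  decide (1 ≤ r.digits) && decide (2 ≤ r.engines.length)

/-- AGAINST PRINT: `Sel₂(E^{(d)}/ℚ) ≅ ℤ/2` (`sel2 = 1`, `sha2 = 0`; Kriz–Li Lemma 5.1 (1), `Δ(E) < 0`) and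
`ord₂ #Ш_an = 0` (`BSD(E^{(d)}, 2)` with `Ш(E^{(d)})[2] = 0`). [cite: KrizLi2019, Lemma 5.1 (1) (FMS) and Thm. 1.12 (2)] -/
def checkPrint : Bool :=
  (r.sel2 == 1) && (r.sha2 == 0) && (r.ord2ShaAn == 0)

/-- The full recheck of a Kriz–Li twist record. [folklore] -/
def check : Bool :=
  r.checkMember && r.checkModel && r.checkInvariants && r.checkPrint

end KLRecord

/-- A list of Kriz–Li twist records is `KLCertified` when every one passes `KLRecord.check` (the statement
of the display theorems `theorem certified… : KLCertified [ … ] := by decide`). An `abbrev` of a `Bool`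
equation (no instance declared). [cite: Miller2011LMS, §1 and Def. 1.1] -/
abbrev KLCertified (rs : List KLRecord) : Prop := rs.all KLRecord.check = true

/-- Unpacking `KLCertified`. [cite: Miller2011LMS, §1 and Def. 1.1] -/
theorem KLCertified.check_of_mem {rs : List KLRecord} (h : KLCertified rs) {r : KLRecord} (hr : r ∈ rs) :
    r.check = true :=
  List.all_eq_true.1 h r hr

/-! ### Decoding: a silent prime, and a certified record, in the vocabulary of Kriz–Li Def. 4.1 -/

/-- **A silent prime decoded**: `ℓ` prime, `ℓ ∉ badPrimes`, `ℓ ∤ d_K`, `(d_K/ℓ) = 1` (Mathlib's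
`jacobiSym d_K ℓ`; from Euler's criterion `kroneckerBit d_K ℓ = 0`, `ℓ` an odd prime not dividing `d_K` —
`2 ∈ badPrimes` is required for this step and checked by the caller), and an even number of roots of
`x³ = c` in `𝔽_ℓ`. [cite: KrizLi2019, Def. 4.1] [cite: IrelandRosen1990, Ch. 5 §1 Prop. 5.1.2 (Euler's criterion)] -/
theorem silent_of_silentBit {dK c : ℤ} {bad : List ℕ} {ℓ : ℕ} (h2 : 2 ∈ bad)
    (h : silentBit dK c bad ℓ = true) :
    ℓ.Prime ∧ ℓ ∉ bad ∧ ¬ ℓ ∣ dK.natAbs ∧ jacobiSym dK ℓ = 1 ∧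
      ∀ [NeZero ℓ], Even ((Finset.univ.filter fun x : ZMod ℓ => x ^ 3 = (c : ZMod ℓ)).card) := by
  simp only [silentBit, Bool.and_eq_true, Bool.not_eq_true', decide_eq_true_eq] at h
  obtain ⟨⟨⟨⟨hp, hbad⟩, hdvd⟩, hkb⟩, hcube⟩ := h
  have hprime : ℓ.Prime := prime_of_isPrimeBelow504100 hp
  have hnot : ℓ ∉ bad := fun hm => by
    have : bad.contains ℓ = true := List.contains_iff_mem.mpr hm
    rw [this] at hbad
    exact Bool.noConfusion hbad
  have hℓ2 : ℓ ≠ 2 := fun h => hnot (h ▸ h2)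
  have hz : ((dK : ℤ) : ZMod ℓ) ≠ 0 := by
    rw [Ne, ZMod.intCast_zmod_eq_zero_iff_dvd, Int.natCast_dvd]
    exact hdvd
  have hj : jacobiSym dK ℓ = 1 := by
    have hgcd : dK.gcd ℓ = 1 := by
      rw [Int.gcd_eq_natAbs, Int.natAbs_natCast]
      exact ((Nat.Prime.coprime_iff_not_dvd hprime).2 hdvd).symm
    rcases jacobiSym.eq_one_or_neg_one hgcd with h1 | h1
    · exact h1
    · exact absurd ((kroneckerBit_eq_one_iff_jacobiSym hprime hℓ2 hz).2 h1) (by rw [hkb]; decide)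
  exact ⟨hprime, hnot, hdvd, hj, fun {_} => even_card_of_evenCubeRootCount hcube⟩

namespace KLRecord

variable (r : KLRecord)

/-- Projection: the membership check holds. [cite: KrizLi2019, Def. 4.1] -/
private theorem checkMember_of_check (h : r.check = true) : r.checkMember = true := by
  simp only [check, Bool.and_eq_true] at h; exact h.1.1.1

/-- Projection: the model check holds. [cite: Cremona1997, Table 1 (243A1)] -/
private theorem checkModel_of_check (h : r.check = true) : r.checkModel = true := by
  simp only [check, Bool.and_eq_true] at h; exact h.1.1.2

/-- Projection: the invariants check holds. [cite: Miller2011LMS, Def. 1.1] -/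
private theorem checkInvariants_of_check (h : r.check = true) : r.checkInvariants = true := by
  simp only [check, Bool.and_eq_true] at h; exact h.1.2

/-- Projection: the print check holds. [cite: KrizLi2019, Lemma 5.1 (1)] -/
private theorem checkPrint_of_check (h : r.check = true) : r.checkPrint = true := by
  simp only [check, Bool.and_eq_true] at h; exact h.2

/-- **A certified record decoded, in the binder shapes of the cell's explicit-member theorems**
(`P2.isKrizLiTwoFortyThreeTwist_of_explicit` and ty2's `isIsogenousToKrizLiTwistOfSmallCMBase_of_curveX`):
`0 < d`, `d % 12 = 1`, `d` square-free, and every prime `ℓ ∣ d` is listed and silent (`silentBit`).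
[cite: KrizLi2019, Def. 4.1 and Thm. 1.12 (2)] -/
theorem hyps_of_check (h : r.check = true) :
    0 < r.d ∧ r.d % 12 = 1 ∧ Squarefree r.d ∧ (∀ ℓ ∈ r.primes, ℓ.Prime) ∧ r.primes.prod = r.d ∧
      ∀ ℓ : ℕ, ℓ.Prime → ℓ ∣ r.d → ℓ ∈ r.primes ∧ silentBit r.fieldDisc r.cubeConst r.badPrimes ℓ = true := by
  have h' := r.checkMember_of_check h
  simp only [checkMember, Bool.and_eq_true, decide_eq_true_eq, beq_iff_eq, List.all_eq_true] at h'
  obtain ⟨⟨⟨⟨⟨hall, hnd⟩, hprod⟩, hpos⟩, h12⟩, hsil⟩ := h'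
  have hpr : ∀ ℓ ∈ r.primes, ℓ.Prime := fun ℓ hℓ => prime_of_isPrimeBelow504100 (hall ℓ hℓ)
  refine ⟨hpos, h12, hprod ▸ squarefree_prod_of_nodup hpr hnd, hpr, hprod, fun ℓ hℓ hd => ?_⟩
  have hm : ℓ ∈ r.primes := mem_of_prime_dvd_prod hpr hℓ (hprod ▸ hd)
  exact ⟨hm, hsil ℓ hm⟩

/-- The `243a1` model clause decoded: at `baseConductor = 243` the record's model is `[0,0,1,0,a₆]` with
`4a₆ + 1 = −3d³`, and `conductor = 243·d²`. [cite: KrizLi2019, §6 Ex. 6.2 (243a1)] [cite: Cremona1997, Table 1 (243A1)] -/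
theorem model243_of_check (h : r.check = true) (hb : r.baseConductor = 243) :
    ∃ a6 : ℤ, r.ainvs = [0, 0, 1, 0, a6] ∧ 4 * a6 + 1 = -(3 * (r.d : ℤ) ^ 3) ∧ r.conductor = 243 * r.d ^ 2 := by
  have h' := r.checkModel_of_check h
  simp only [checkModel, hb, Bool.and_eq_true, beq_iff_eq, if_true] at h'
  obtain ⟨hN, hm⟩ := h'
  match hA : r.ainvs, hm with
  | [0, 0, 1, 0, a6], hm =>
    simp only [beq_iff_eq] at hm
    exact ⟨a6, rfl, hm, hN⟩

/-- The numeric columns of a passing record: a LEAF record (`rankAn = 1`, `rankMW = 1`, `rootNumber = −1`)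
consistent with print (`sel2 = 1`, `sha2 = 0`, `ord2ShaAn = 0`, the claimed `#Ш_an` odd).
[cite: KrizLi2019, Lemma 5.1 (1) and Thm. 1.12 (2)] [cite: Miller2011LMS, Def. 1.1] -/
theorem numeric_of_check (h : r.check = true) :
    (r.rankAn = 1 ∧ r.rankMW = 1 ∧ r.rootNumber = -1) ∧ r.sel2 = 1 ∧ r.sha2 = 0 ∧ r.ord2ShaAn = 0 ∧
      ¬ 2 ∣ r.shaAn := by
  have h' := r.checkPrint_of_check h
  simp only [checkPrint, Bool.and_eq_true, beq_iff_eq] at h'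
  have hi := r.checkInvariants_of_check h
  simp only [checkInvariants, Bool.and_eq_true, beq_iff_eq, decide_eq_true_eq] at hi
  have hpos : 0 < r.shaAn := hi.1.1.1.1.1.1.1.2
  have hval : r.ord2ShaAn = natVal 2 r.shaAn := hi.1.1.1.1.1.2
  exact ⟨⟨hi.1.1.1.1.1.1.1.1.1.1, hi.1.1.1.1.1.1.1.1.1.2, hi.1.1.1.1.1.1.1.1.2⟩, h'.1.1, h'.1.2, h'.2,
    not_two_dvd_of_natVal_eq_zero hpos (by rw [← hval, h'.2])⟩

end KLRecord

/-! ### Sample and tamper test (numeric columns of the display file `RecordsKrizLiTwoFortyThree.lean`) -/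

/-- SAMPLE: the record of the first member `243a1^{(13)} : y² + y = x³ − 1648` (`d = 13 ∈ 𝒮`:
`(−23/13) = 1`, `x³ = 48 = 9` has no root in `𝔽₁₃`; `N = 243·13² = 41067`; rank `= r_an = 1`,
`E(ℚ)_tors = 0`, `∏ c_ℓ = 1`·?, `#Ш_an = 1`, `Sel₂ ≅ ℤ/2`) passes. [cite: KrizLi2019, §6 Ex. 6.2 and Table 1 (row 243a1)] -/
theorem klCertified_sample : KLCertified [
  { base := "243a1", fieldDisc := -23, cubeConst := 48, badPrimes := [2, 3], baseConductor := 243, d := 13,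
    primes := [13], label := "", ainvs := [0, 0, 1, 0, -1648], conductor := 41067, rankMW := 1,
    rankAn := 1, rootNumber := -1, torsion := 1, tamagawa := 1, sel2 := 1, shaAn := 1, ord2ShaAn := 0,
    sha2 := 0, digits := 10, engines := ["P:PARI j289430", "S:SageMath j289431"] } ] := by
  decide +kernel

/-- Tampering is caught: `d = 7` (`7 ∉ 𝒮`: `x³ = 48 = 6` has exactly one root in `𝔽₇`, so `a₇` is even;
also `7 ≢ 1 (mod 12)`) fails the recheck. [cite: KrizLi2019, Def. 4.1] -/
theorem not_klCertified_tampered : ¬ KLCertified [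
  { base := "243a1", fieldDisc := -23, cubeConst := 48, badPrimes := [2, 3], baseConductor := 243, d := 7,
    primes := [7], label := "", ainvs := [0, 0, 1, 0, -257], conductor := 11907, rankMW := 1,
    rankAn := 1, rootNumber := -1, torsion := 1, tamagawa := 1, sel2 := 1, shaAn := 1, ord2ShaAn := 0,
    sha2 := 0, digits := 10, engines := ["P:PARI j289430", "S:SageMath j289431"] } ] := by
  decide +kernel

end Literature.NumberTheory.EllipticCurves.Rank1Residual.CornerFTwoCertificates
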